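import Summits.BirchSwinnertonDyer.BirchSwinnertonDyer.Theorems.ErratumRoadFiveIMCDivRoadFFFittingCutBFeed
import Summits.BirchSwinnertonDyer.BirchSwinnertonDyer.Theorems.ErratumRoadFiveCpIntReceptaclePurity
import HarnessLib

/-!
# Road FF, crux `IMCDivAtErratumDataAllR` (item stmt-BirchSwinnertonDyer-20169): the one-sided congruence limit and the
# two-slot Fitting congruence frame with the member data read in the receptacle `𝓞_{ℂ_p}⟦T⟧` (PURE, not faithfully flat)

Cell `bsd-stepL` (run/shared/lean/pub/bsd-stepL/), seat `bsd-stepL-imc-p1` (prover g15, 2026-08-28);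
`--supports stmt-BirchSwinnertonDyer-20169 --as helper`. Theses-free; THEOREMS ONLY; no definition, no named fact, no
`sorry`, no instance. Design memo `HOME/imc-p1/g15/FSPLIT-DESIGN-20529-imc-p1-g15.md` §3 (K1)+(G).

## What this file proves and why

imc-p1 g8's coefficient-honest congruence limit `CongruenceDescent.map_le_span_of_oneSided_congruences_descent_le`
(p489585) and its feeder `P2.RoadFF.fittingCongruenceFrameTwoSlotAt_of_members_descent_le` (p495387) read the member data —
(2.5)_m `Fitt(N_m)·S'_m ⊆ (L_m)` and the one-sided (c) `(L_m) ⊆ (L^Σ) + (p^m)` — in receptacles `S'_m` FAITHFULLY FLAT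
over `R₀⟦T⟧` (in the cell's assemblies: `(R₀ ⊗_{ℤ_p} 𝒪_m)⟦T⟧`, T4). Faithful flatness is used ONLY to contract the ideal
`(L^Σ) + (p^m)` from `S'_m` to `R₀⟦T⟧`. This file replaces the instance `[Module.FaithfullyFlat S (S' m)]` by exactly that
PURITY hypothesis (`…_of_pure`, §1), and instantiates it at the CONSTANT receptacle `S'_m := 𝓞_{ℂ_p}⟦T⟧` (§2–§3), where
purity for the ideals containing `p^m` is the tree's `ReceptaclePurity.comap_map_unrToCpInt_eq_of_C_pow_mem` (g15,
`Theorems/ErratumRoadFiveCpIntReceptaclePurity.lean`: self-injectivity of `R₀/p^m`). Consequence: Hida members whose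
`p`-adic `L`-functions are DEFINITE elements `L_m ∈ 𝓞_{ℂ_p}⟦T⟧` (the natural host of a weight-`k` frame with coefficients in
`𝒪_m ⊄ R₀`; tree `R1.IsBDPLFunctionInt` at weight `2`) feed the Road-FF cut with NO tensor-product receptacle and NO
flatness input:

* §1 `CongruenceDescent.map_fittingIdeal_le_sup_of_congruence_descent_le_of_pure`,
  `CongruenceDescent.map_le_span_of_oneSided_congruences_descent_le_of_pure` (generic: any `S → S'_m` contracting the
  ideals `(L) + φ(I)^m S`);
* §2 `AcSelmer.XAc.map_fittingIdeal_le_span_of_oneSided_congruences_descent_le_cpInt` (Fitting-level members) and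
  `…_cpInt_printed` (members in the PRINTED shape «`N_m` torsion → `Ch_{R'_m}(N_m)·𝓞_{ℂ_p}⟦T⟧ ⊆ (L_m)`» over Noetherian UFDs
  `R'_m = 𝒪_m⟦T⟧`): `Fitt₀_Λ(X^Σ)·R₀⟦T⟧ ⊆ (L^Σ)`;
* §3 `P2.RoadFF.fittingCongruenceFrameTwoSlotAt_of_members_descent_le_cpInt(_printed)` — the two-slot Fitting congruence
  frame of the Road-FF cut from an `R₀`-frame of `f` at `𝔭`, `L^Σ`, and members read in `𝓞_{ℂ_p}⟦T⟧`.

HONEST FRAMING: pure algebra on the constructed module `X^Σ_ac`; CONDITIONAL on the displayed member inputs ((2.5)_m is where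
[FW21, Thm. 4.41] would enter — PREPRINT — nothing of it is asserted here); BSD is proved for no pair; no census number moves (T7).

References: [Castella2018Erratum] (b), (c), Lemma 2.1, (2.5), proof of Thm. 1.1 (pp. 2–4), read one-sidedly;
[Skinner2016PacificMC] §2.6, §3.1 (p. 192); [Castella2018] Thm. 3.1, (3.1) (arXiv:1704.06608 p. 9); [StacksProject] 07ZA (3),
05GI; [Lam1999] (4.92)–(4.93) (purity); [FouquetWan2021] Thm. 4.41 (shape of (2.5)_m only).
-/

set_option autoImplicit false

noncomputable section

open scoped Classical TensorProduct

open PowerSeries Literature.NumberTheory.EllipticCurves Literature.NumberTheory.EllipticCurves.Module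
  Literature.NumberTheory.EllipticCurves.ModularForms Literature.RingTheory.FittingIdeal NumberField IsDedekindDomain Field
open Summit.BirchSwinnertonDyer.Rank1Residual.X11b.AcSelmer Summit.BirchSwinnertonDyer.Rank1Residual.X11b.Halves
  Summit.BirchSwinnertonDyer.Rank1Residual.X2

namespace Summit.BirchSwinnertonDyer.Rank1Residual.X11b

/-! ### §1 The one-sided congruence limit across `φ : R → S`, receptacles PURE for the ideals `(L) + φ(I)^m` -/

namespace CongruenceDescent

universe u v w

variable {R : Type*} [CommRing R] {S : Type u} [CommRing S] (φ : R →+* S) (I : Ideal R)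
  {M : Type*} [AddCommGroup M] [Module R M] [Module.Finite R M]

/-- **One congruence step with its own coefficients, (c) ONE-SIDED, contracted to `S` by PURITY.** As
`map_fittingIdeal_le_sup_of_congruence_descent_le` (p489585) with the instance `[Module.FaithfullyFlat S S']` replaced by
the one contraction it is used for: `((L) + φ(I)^m)·S' ∩ S = (L) + φ(I)^m`. Data: a commutative square
`R → R' →(φ') S' ← S`, a finite `R'`-module `N`, an `R'`-isomorphism `(R' ⊗_R M)/I^m ≅ N/I^m` [(b) + Lemma 2.1], the member
inclusion `Fitt_{R'}(N)·S' ⊆ (L_m)` [(2.5)_m] and `(L_m) ⊆ (L·1_{S'}) + I^m S'` [(c)]. Then `Fitt_R(M)·S ⊆ (L) + I^m S`.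
[cite: Skinner2016PacificMC, §3.1 (p. 192)] [cite: Castella2018Erratum, proof of Thm. 1.1 (p. 4), read one-sidedly]
[cite: StacksProject, Tag 07ZA (3)] -/
theorem map_fittingIdeal_le_sup_of_congruence_descent_le_of_pure
    (R' : Type v) [CommRing R'] [Algebra R R'] (S' : Type w) [CommRing S'] [Algebra S S']
    (φ' : R' →+* S')
    (hφ' : φ'.comp (algebraMap R R') = (algebraMap S S').comp φ)
    (N : Type*) [AddCommGroup N] [Module R' N] [Module.Finite R' N] {L : S} {Lm : S'} {m : ℕ}
    (hpure : ((Ideal.span {L} ⊔ (I.map φ) ^ m).map (algebraMap S S')).comap (algebraMap S S') =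
      Ideal.span {L} ⊔ (I.map φ) ^ m)
    (e : ((R' ⊗[R] M) ⧸ ((I.map (algebraMap R R')) ^ m • (⊤ : Submodule R' (R' ⊗[R] M)))) ≃ₗ[R']
      (N ⧸ ((I.map (algebraMap R R')) ^ m • (⊤ : Submodule R' N))))
    (hF : (Module.fittingIdeal R' N 0).map φ' ≤ Ideal.span {Lm})
    (hc : Ideal.span {Lm} ≤
      Ideal.span {algebraMap S S' L} ⊔ ((I.map φ).map (algebraMap S S')) ^ m) :
    (Module.fittingIdeal R M 0).map φ ≤ Ideal.span {L} ⊔ (I.map φ) ^ m := by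
  -- the proof of p489585's `map_fittingIdeal_le_sup_of_congruence_descent_le`, the last step by `hpure`
  set ψ : S →+* S' := algebraMap S S' with hψ
  have hcomp : ψ.comp φ = φ'.comp (algebraMap R R') := by rw [hψ, hφ']
  have hA : ((Module.fittingIdeal R M 0).map φ).map ψ =
      (Module.fittingIdeal R' (R' ⊗[R] M) 0).map φ' := by
    rw [Ideal.map_map, hcomp, ← Ideal.map_map, Module.fittingIdeal_baseChange]
  have hB : ((I.map φ) ^ m).map ψ = ((I.map (algebraMap R R')) ^ m).map φ' := by
    rw [Ideal.map_pow, Ideal.map_pow, Ideal.map_map, Ideal.map_map, hcomp]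
  have hB' : ((I.map φ).map ψ) ^ m = ((I.map (algebraMap R R')) ^ m).map φ' := by
    rw [← Ideal.map_pow, hB]
  have hC : (Ideal.span {L}).map ψ = Ideal.span {ψ L} := by
    rw [Ideal.map_span, Set.image_singleton]
  have hstep : (Module.fittingIdeal R' (R' ⊗[R] M) 0).map φ' ≤
      Ideal.span {Lm} ⊔ ((I.map (algebraMap R R')) ^ m).map φ' := by
    have h1 : (Module.fittingIdeal R' (R' ⊗[R] M) 0).map φ' ≤
        (Module.fittingIdeal R' (R' ⊗[R] M) 0 ⊔ (I.map (algebraMap R R')) ^ m).map φ' :=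
      Ideal.map_mono le_sup_left
    rw [CongruenceLimit.fittingIdeal_sup_eq_of_quotEquiv ((I.map (algebraMap R R')) ^ m) e 0,
      Ideal.map_sup] at h1
    exact h1.trans (sup_le_sup_right hF _)
  have himg : ((Module.fittingIdeal R M 0).map φ).map ψ ≤ (Ideal.span {L} ⊔ (I.map φ) ^ m).map ψ := by
    rw [Ideal.map_sup, hA, hB, hC]
    refine hstep.trans (sup_le ?_ le_sup_right)
    rw [← hB']
    exact hc
  -- contract to `S` (purity of the one ideal)
  have h := Ideal.comap_mono (f := ψ) himg
  rw [hψ, hpure] at h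
  exact Ideal.le_comap_map.trans h

/-- **The one-sided congruence limit with per-member coefficient rings, (c) ONE-SIDED, receptacles PURE for the ideals
`(L) + φ(I)^m S`** — p489585's `map_le_span_of_oneSided_congruences_descent_le` with faithful flatness replaced by the
per-`m` purity hypothesis. `S` Noetherian with `φ(I) ⊆ Jac(S)`; `J ⊆ Fitt_R(M)`; then `J·S ⊆ ⋂_m ((L) + I^m S) = (L)` (Krull).
[cite: Skinner2016PacificMC, §3.1 (p. 192)] [cite: Castella2018Erratum, proof of Thm. 1.1 (p. 4), read one-sidedly]
[cite: StacksProject, Tag 05GI (Krull's intersection theorem)] -/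
theorem map_le_span_of_oneSided_congruences_descent_le_of_pure [IsNoetherianRing S]
    (hI : I.map φ ≤ (⊥ : Ideal S).jacobson) {J : Ideal R} (hJ : J ≤ Module.fittingIdeal R M 0)
    (L : S) (R' : ℕ → Type v) [∀ m, CommRing (R' m)] [∀ m, Algebra R (R' m)]
    (S' : ℕ → Type w) [∀ m, CommRing (S' m)] [∀ m, Algebra S (S' m)]
    (φ' : ∀ m, R' m →+* S' m)
    (hφ' : ∀ m, (φ' m).comp (algebraMap R (R' m)) = (algebraMap S (S' m)).comp φ)
    (hpure : ∀ m : ℕ, 1 ≤ m →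
      ((Ideal.span {L} ⊔ (I.map φ) ^ m).map (algebraMap S (S' m))).comap (algebraMap S (S' m)) =
        Ideal.span {L} ⊔ (I.map φ) ^ m)
    (N : ℕ → Type*) [∀ m, AddCommGroup (N m)] [∀ m, Module (R' m) (N m)]
    [∀ m, Module.Finite (R' m) (N m)] (Lm : ∀ m, S' m)
    (e : ∀ m : ℕ, 1 ≤ m →
      (((R' m ⊗[R] M) ⧸ ((I.map (algebraMap R (R' m))) ^ m •
          (⊤ : Submodule (R' m) (R' m ⊗[R] M)))) ≃ₗ[R' m]
        (N m ⧸ ((I.map (algebraMap R (R' m))) ^ m • (⊤ : Submodule (R' m) (N m))))))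
    (hF : ∀ m : ℕ, 1 ≤ m → (Module.fittingIdeal (R' m) (N m) 0).map (φ' m) ≤ Ideal.span {Lm m})
    (hc : ∀ m : ℕ, 1 ≤ m →
      Ideal.span {Lm m} ≤
        Ideal.span {algebraMap S (S' m) L} ⊔ ((I.map φ).map (algebraMap S (S' m))) ^ m) :
    J.map φ ≤ Ideal.span {L} := by
  refine (Ideal.map_mono hJ).trans ?_
  rw [← CongruenceLimit.iInf_sup_pow_eq_self (I.map φ) (Ideal.span {L}) hI]
  refine le_iInf fun m ↦ ?_
  rcases Nat.eq_zero_or_pos m with rfl | hm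
  · rw [pow_zero, Ideal.one_eq_top, sup_top_eq]; exact le_top
  · exact le_sup_left.trans (sup_le
      (map_fittingIdeal_le_sup_of_congruence_descent_le_of_pure φ I (R' m) (S' m) (φ' m) (hφ' m) (N m)
        (hpure m hm) (e m hm) (hF m hm) (hc m hm)) le_sup_right)

end CongruenceDescent

/-! ### §2 On `X^Σ = X_ac^Σ(E[p^∞])` with the constant receptacle `𝓞_{ℂ_p}⟦T⟧` -/

section XAc

variable {K : Type} [Field K] [NumberField K] (E : WeierstrassCurve K) [E.IsElliptic]
  (p : ℕ) [Fact p.Prime] (κ : ZpExtension K p) (𝔭 : HeightOneSpectrum (𝓞 K))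
  {S : Set (HeightOneSpectrum (𝓞 K))} (γ : Field.absoluteGaloisGroup K) [Fact (κ.IsTopGenerator γ)]

universe v

/-- `(p^m)` in `𝓞_{ℂ_p}⟦T⟧`, spelled with `C`, is the image of `((C p) ⊆ Λ)^m` along `Λ → R₀⟦T⟧ → 𝓞_{ℂ_p}⟦T⟧`. [folklore] -/
theorem map_map_span_C_p_pow (m : ℕ) :
    (((Ideal.span {(PowerSeries.C (p : ℤ_[p]) : IwasawaAlgebra p)}).map (PowerSeries.map (toUnr p))).map
        (PowerSeries.map (R1.unrToCpInt p))) ^ m =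
      Ideal.span {(PowerSeries.C (((p : ℕ) : 𝓞_ℂ_[p]) ^ m) : PowerSeries 𝓞_ℂ_[p])} := by
  rw [HidaLimitAlgebra.map_span_C_p, ← Ideal.map_pow, ReceptaclePurity.map_span_C_pow, Ideal.span_singleton_pow,
    map_pow]

/-- **The member limit ON `X^Σ` at the FITTING level, members read in `𝓞_{ℂ_p}⟦T⟧`.** `Σ` finite; for each `m ≥ 1` a
coefficient ring `R'_m` over `Λ` (`= 𝒪_m⟦T⟧`) with a ring map `φ'_m : R'_m → 𝓞_{ℂ_p}⟦T⟧` compatible with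
`Λ → R₀⟦T⟧ → 𝓞_{ℂ_p}⟦T⟧`, a finite `R'_m`-module `N_m` with `(R'_m ⊗_Λ X^Σ)/p^m ≅ N_m/p^m` [(b) + Lemma 2.1],
`Fitt_{R'_m}(N_m)·𝓞_{ℂ_p}⟦T⟧ ⊆ (L_m)` [⟸ (2.5)_m] and `(L_m) ⊆ (L^Σ) + (p^m)` in `𝓞_{ℂ_p}⟦T⟧` [(c)], `L_m ∈ 𝓞_{ℂ_p}⟦T⟧`.
THEN `Fitt₀_Λ(X^Σ)·R₀⟦T⟧ ⊆ (L^Σ)`. No tensor-product receptacle, no flatness: the contraction is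
`ReceptaclePurity.comap_map_unrToCpInt_eq_of_C_pow_mem`. CONDITIONAL on the displayed inputs.
[cite: Castella2018Erratum, Lemma 2.1 and proof of Thm. 1.1 (p. 4), read one-sidedly] [cite: Skinner2016PacificMC, §3.1 (p. 192)] -/
theorem AcSelmer.XAc.map_fittingIdeal_le_span_of_oneSided_congruences_descent_le_cpInt (hS : S.Finite)
    (LS : UnrSeries p) (R' : ℕ → Type v) [∀ m, CommRing (R' m)] [∀ m, Algebra (IwasawaAlgebra p) (R' m)]
    (φ' : ∀ m, R' m →+* PowerSeries 𝓞_ℂ_[p])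
    (hφ' : ∀ m, (φ' m).comp (algebraMap (IwasawaAlgebra p) (R' m)) =
      (PowerSeries.map (R1.unrToCpInt p)).comp (PowerSeries.map (toUnr p)))
    (N : ℕ → Type) [∀ m, AddCommGroup (N m)] [∀ m, Module (R' m) (N m)]
    [∀ m, Module.Finite (R' m) (N m)] (Lm : ℕ → PowerSeries 𝓞_ℂ_[p])
    (e : ∀ m : ℕ, 1 ≤ m →
      (((R' m ⊗[IwasawaAlgebra p] XAc E p κ 𝔭 S γ) ⧸
          (((Ideal.span {(PowerSeries.C (p : ℤ_[p]) : IwasawaAlgebra p)}).map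
              (algebraMap (IwasawaAlgebra p) (R' m))) ^ m •
            (⊤ : Submodule (R' m) (R' m ⊗[IwasawaAlgebra p] XAc E p κ 𝔭 S γ)))) ≃ₗ[R' m]
        (N m ⧸ (((Ideal.span {(PowerSeries.C (p : ℤ_[p]) : IwasawaAlgebra p)}).map
            (algebraMap (IwasawaAlgebra p) (R' m))) ^ m • (⊤ : Submodule (R' m) (N m))))))
    (hF : ∀ m : ℕ, 1 ≤ m → (Module.fittingIdeal (R' m) (N m) 0).map (φ' m) ≤ Ideal.span {Lm m})
    (hc : ∀ m : ℕ, 1 ≤ m →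
      Ideal.span {Lm m} ≤
        Ideal.span {PowerSeries.map (R1.unrToCpInt p) LS} ⊔
          Ideal.span {(PowerSeries.C (((p : ℕ) : 𝓞_ℂ_[p]) ^ m) : PowerSeries 𝓞_ℂ_[p])}) :
    (Module.fittingIdeal (IwasawaAlgebra p) (XAc E p κ 𝔭 S γ) 0).map (PowerSeries.map (toUnr p)) ≤
      Ideal.span {LS} := by
  haveI : Module.Finite (IwasawaAlgebra p) (XAc E p κ 𝔭 S γ) := XAc.module_finite κ 𝔭 S γ hS
  haveI := HidaLimitAlgebra.isNoetherianRing_unrSeries (p := p)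
  letI : Algebra (UnrSeries p) (PowerSeries 𝓞_ℂ_[p]) := (PowerSeries.map (R1.unrToCpInt p)).toAlgebra
  have halg : algebraMap (UnrSeries p) (PowerSeries 𝓞_ℂ_[p]) = PowerSeries.map (R1.unrToCpInt p) := rfl
  have hI : (Ideal.span {(PowerSeries.C (p : ℤ_[p]) : IwasawaAlgebra p)}).map
      (PowerSeries.map (toUnr p)) ≤ (⊥ : Ideal (UnrSeries p)).jacobson := by
    rw [HidaLimitAlgebra.map_span_C_p]
    exact HidaLimitAlgebra.span_C_p_le_jacobson_unrSeries
  refine CongruenceDescent.map_le_span_of_oneSided_congruences_descent_le_of_pure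
    (PowerSeries.map (toUnr p)) (Ideal.span {(PowerSeries.C (p : ℤ_[p]) : IwasawaAlgebra p)}) hI
    (le_refl (Module.fittingIdeal (IwasawaAlgebra p) (XAc E p κ 𝔭 S γ) 0)) LS R'
    (fun _ => PowerSeries 𝓞_ℂ_[p]) φ' (fun m => by rw [halg]; exact hφ' m) (fun m _ => ?_) N Lm e hF
    (fun m hm => ?_)
  · -- purity of `(L^Σ) + (p)^m` along `R₀⟦T⟧ → 𝓞_{ℂ_p}⟦T⟧`
    rw [halg]
    refine ReceptaclePurity.comap_map_unrToCpInt_eq_of_C_pow_mem _ (m := m) (Ideal.mem_sup_right ?_)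
    rw [HidaLimitAlgebra.map_span_C_p, Ideal.span_singleton_pow, map_pow]
    exact Ideal.mem_span_singleton_self _
  · rw [halg, map_map_span_C_p_pow]
    exact hc m hm

/-- **The same member limit with (2.5)_m in its PRINTED shape read in `𝓞_{ℂ_p}⟦T⟧`** — «`N_m` torsion →
`Ch_{R'_m}(N_m)·𝓞_{ℂ_p}⟦T⟧ ⊆ (L_m)`» over Noetherian UFDs `R'_m` (`= 𝒪_m⟦T⟧`), converted to the Fitting level by imc24c's
`CongruenceDescent.map_fittingIdeal_le_of_printed_charIdeal_le`. Output: `Fitt₀_Λ(X^Σ)·R₀⟦T⟧ ⊆ (L^Σ)`. CONDITIONAL on the inputs.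
[cite: Castella2018Erratum, (2.5) and proof of Thm. 1.1 (p. 4), read one-sidedly] [cite: FouquetWan2021, Thm. 4.41 (shape of the conclusion)] -/
theorem AcSelmer.XAc.map_fittingIdeal_le_span_of_oneSided_congruences_descent_le_cpInt_printed (hS : S.Finite)
    (LS : UnrSeries p) (R' : ℕ → Type v) [∀ m, CommRing (R' m)]
    [∀ m, IsNoetherianRing (R' m)] [∀ m, IsDomain (R' m)] [∀ m, UniqueFactorizationMonoid (R' m)]
    [∀ m, Algebra (IwasawaAlgebra p) (R' m)]
    (φ' : ∀ m, R' m →+* PowerSeries 𝓞_ℂ_[p])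
    (hφ' : ∀ m, (φ' m).comp (algebraMap (IwasawaAlgebra p) (R' m)) =
      (PowerSeries.map (R1.unrToCpInt p)).comp (PowerSeries.map (toUnr p)))
    (N : ℕ → Type) [∀ m, AddCommGroup (N m)] [∀ m, Module (R' m) (N m)]
    [∀ m, Module.Finite (R' m) (N m)] (Lm : ℕ → PowerSeries 𝓞_ℂ_[p])
    (e : ∀ m : ℕ, 1 ≤ m →
      (((R' m ⊗[IwasawaAlgebra p] XAc E p κ 𝔭 S γ) ⧸
          (((Ideal.span {(PowerSeries.C (p : ℤ_[p]) : IwasawaAlgebra p)}).map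
              (algebraMap (IwasawaAlgebra p) (R' m))) ^ m •
            (⊤ : Submodule (R' m) (R' m ⊗[IwasawaAlgebra p] XAc E p κ 𝔭 S γ)))) ≃ₗ[R' m]
        (N m ⧸ (((Ideal.span {(PowerSeries.C (p : ℤ_[p]) : IwasawaAlgebra p)}).map
            (algebraMap (IwasawaAlgebra p) (R' m))) ^ m • (⊤ : Submodule (R' m) (N m))))))
    (hCh : ∀ m : ℕ, 1 ≤ m → Module.IsTorsion (R' m) (N m) →
      (Module.charIdeal (R' m) (N m)).map (φ' m) ≤ Ideal.span {Lm m})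
    (hc : ∀ m : ℕ, 1 ≤ m →
      Ideal.span {Lm m} ≤
        Ideal.span {PowerSeries.map (R1.unrToCpInt p) LS} ⊔
          Ideal.span {(PowerSeries.C (((p : ℕ) : 𝓞_ℂ_[p]) ^ m) : PowerSeries 𝓞_ℂ_[p])}) :
    (Module.fittingIdeal (IwasawaAlgebra p) (XAc E p κ 𝔭 S γ) 0).map (PowerSeries.map (toUnr p)) ≤
      Ideal.span {LS} :=
  AcSelmer.XAc.map_fittingIdeal_le_span_of_oneSided_congruences_descent_le_cpInt E p κ 𝔭 γ hS LS R' φ' hφ' N Lm e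
    (fun m hm ↦ CongruenceDescent.map_fittingIdeal_le_of_printed_charIdeal_le (φ' m) (hCh m hm)) hc

end XAc

/-! ### §3 The two-slot Fitting congruence frame of the Road-FF cut from members read in `𝓞_{ℂ_p}⟦T⟧` -/

section Feed

variable {K : Type} [Field K] [NumberField K] {W : WeierstrassCurve ℚ} [W.IsElliptic] {p : ℕ}
  [Fact p.Prime] {κ : ZpExtension K p} {𝔭 𝔮 : HeightOneSpectrum (𝓞 K)} {γ : Field.absoluteGaloisGroup K}
  [Fact (κ.IsTopGenerator γ)] {ι : PadicAlgCl p ≃+* ℂ} {N : ℕ}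
  {f : CuspForm (CongruenceSubgroup.Gamma0 N) 2}
  {S : Set (HeightOneSpectrum (𝓞 K))} {PS : IwasawaAlgebra p}

universe v

/-- **Hida members read in `𝓞_{ℂ_p}⟦T⟧` feed the TWO-SLOT congruence frame, (2.5)_m at FITTING level.** An `R₀`-frame of `f`
at the frame prime `𝔭` [Cas18 Thm. 3.1], `L^Σ` with `L·φ(P_Σ) ∣ L^Σ` [Cas18 (3.1)], `Σ` finite, and for every `m ≥ 1` a coefficient
ring `R'_m` over `Λ` with `φ'_m : R'_m → 𝓞_{ℂ_p}⟦T⟧` over `Λ → R₀⟦T⟧ → 𝓞_{ℂ_p}⟦T⟧`, a finite `R'_m`-module `N_m`, an `R'_m`-isomorphism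
`(R'_m ⊗_Λ X^Σ_𝔮)/p^m ≅ N_m/p^m` [(b) + Lemma 2.1], `Fitt_{R'_m}(N_m)·𝓞_{ℂ_p}⟦T⟧ ⊆ (L_m)` [(2.5)_m] and `(L_m) ⊆ (L^Σ) + (p^m)` in
`𝓞_{ℂ_p}⟦T⟧` [(c)] ⟹ `P2.RoadFF.FittingCongruenceFrameTwoSlotAt W p κ 𝔭 𝔮 γ ι f S PS`. CONDITIONAL on the displayed inputs.
[cite: Castella2018Erratum, proof of Thm. 1.1 (p. 4), read one-sidedly] [cite: Skinner2016PacificMC, §3.1 (p. 192)] -/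
theorem P2.RoadFF.fittingCongruenceFrameTwoSlotAt_of_members_descent_le_cpInt {ΩK : ℂ} {Ωp : (unrIntegers p)ˣ}
    {L : UnrSeries p} (hΩ : ΩK ≠ 0)
    (hL : IsBDPLFunction ι 𝔭 κ γ f ΩK ((Ωp : unrIntegers p) : ℂ_[p]) L)
    (LS : UnrSeries p) (hLS : L * PowerSeries.map (toUnr p) PS ∣ LS) (hS : S.Finite)
    (R' : ℕ → Type v) [∀ m, CommRing (R' m)] [∀ m, Algebra (IwasawaAlgebra p) (R' m)]
    (φ' : ∀ m, R' m →+* PowerSeries 𝓞_ℂ_[p])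
    (hφ' : ∀ m, (φ' m).comp (algebraMap (IwasawaAlgebra p) (R' m)) =
      (PowerSeries.map (R1.unrToCpInt p)).comp (PowerSeries.map (toUnr p)))
    (Nm : ℕ → Type) [∀ m, AddCommGroup (Nm m)] [∀ m, Module (R' m) (Nm m)]
    [∀ m, Module.Finite (R' m) (Nm m)] (Lm : ℕ → PowerSeries 𝓞_ℂ_[p])
    (e : ∀ m : ℕ, 1 ≤ m →
      (((R' m ⊗[IwasawaAlgebra p] XAc (W.baseChange K) p κ 𝔮 S γ) ⧸
          (((Ideal.span {(PowerSeries.C (p : ℤ_[p]) : IwasawaAlgebra p)}).map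
              (algebraMap (IwasawaAlgebra p) (R' m))) ^ m •
            (⊤ : Submodule (R' m) (R' m ⊗[IwasawaAlgebra p] XAc (W.baseChange K) p κ 𝔮 S γ))))
          ≃ₗ[R' m]
        (Nm m ⧸ (((Ideal.span {(PowerSeries.C (p : ℤ_[p]) : IwasawaAlgebra p)}).map
            (algebraMap (IwasawaAlgebra p) (R' m))) ^ m • (⊤ : Submodule (R' m) (Nm m))))))
    (hF : ∀ m : ℕ, 1 ≤ m → (Module.fittingIdeal (R' m) (Nm m) 0).map (φ' m) ≤ Ideal.span {Lm m})
    (hc : ∀ m : ℕ, 1 ≤ m →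
      Ideal.span {Lm m} ≤
        Ideal.span {PowerSeries.map (R1.unrToCpInt p) LS} ⊔
          Ideal.span {(PowerSeries.C (((p : ℕ) : 𝓞_ℂ_[p]) ^ m) : PowerSeries 𝓞_ℂ_[p])}) :
    P2.RoadFF.FittingCongruenceFrameTwoSlotAt W p κ 𝔭 𝔮 γ ι f S PS :=
  ⟨ΩK, Ωp, L, LS, hΩ, hL, hLS,
    AcSelmer.XAc.map_fittingIdeal_le_span_of_oneSided_congruences_descent_le_cpInt (W.baseChange K) p κ 𝔮 γ
      hS LS R' φ' hφ' Nm Lm e hF hc⟩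

/-- **The same feed with the members in the PRINTED shape of (2.5)_m** («`N_m` torsion → `Ch_{R'_m}(N_m)·𝓞_{ℂ_p}⟦T⟧ ⊆ (L_m)`»,
`R'_m` Noetherian UFDs). CONDITIONAL on the displayed inputs.
[cite: Castella2018Erratum, (2.5) and proof of Thm. 1.1 (p. 4), read one-sidedly] [cite: FouquetWan2021, Thm. 4.41 (shape only)] -/
theorem P2.RoadFF.fittingCongruenceFrameTwoSlotAt_of_members_descent_le_cpInt_printed {ΩK : ℂ}
    {Ωp : (unrIntegers p)ˣ} {L : UnrSeries p} (hΩ : ΩK ≠ 0)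
    (hL : IsBDPLFunction ι 𝔭 κ γ f ΩK ((Ωp : unrIntegers p) : ℂ_[p]) L)
    (LS : UnrSeries p) (hLS : L * PowerSeries.map (toUnr p) PS ∣ LS) (hS : S.Finite)
    (R' : ℕ → Type v) [∀ m, CommRing (R' m)]
    [∀ m, IsNoetherianRing (R' m)] [∀ m, IsDomain (R' m)] [∀ m, UniqueFactorizationMonoid (R' m)]
    [∀ m, Algebra (IwasawaAlgebra p) (R' m)]
    (φ' : ∀ m, R' m →+* PowerSeries 𝓞_ℂ_[p])
    (hφ' : ∀ m, (φ' m).comp (algebraMap (IwasawaAlgebra p) (R' m)) =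
      (PowerSeries.map (R1.unrToCpInt p)).comp (PowerSeries.map (toUnr p)))
    (Nm : ℕ → Type) [∀ m, AddCommGroup (Nm m)] [∀ m, Module (R' m) (Nm m)]
    [∀ m, Module.Finite (R' m) (Nm m)] (Lm : ℕ → PowerSeries 𝓞_ℂ_[p])
    (e : ∀ m : ℕ, 1 ≤ m →
      (((R' m ⊗[IwasawaAlgebra p] XAc (W.baseChange K) p κ 𝔮 S γ) ⧸
          (((Ideal.span {(PowerSeries.C (p : ℤ_[p]) : IwasawaAlgebra p)}).map
              (algebraMap (IwasawaAlgebra p) (R' m))) ^ m •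
            (⊤ : Submodule (R' m) (R' m ⊗[IwasawaAlgebra p] XAc (W.baseChange K) p κ 𝔮 S γ))))
          ≃ₗ[R' m]
        (Nm m ⧸ (((Ideal.span {(PowerSeries.C (p : ℤ_[p]) : IwasawaAlgebra p)}).map
            (algebraMap (IwasawaAlgebra p) (R' m))) ^ m • (⊤ : Submodule (R' m) (Nm m))))))
    (hCh : ∀ m : ℕ, 1 ≤ m → Module.IsTorsion (R' m) (Nm m) →
      (Module.charIdeal (R' m) (Nm m)).map (φ' m) ≤ Ideal.span {Lm m})
    (hc : ∀ m : ℕ, 1 ≤ m →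
      Ideal.span {Lm m} ≤
        Ideal.span {PowerSeries.map (R1.unrToCpInt p) LS} ⊔
          Ideal.span {(PowerSeries.C (((p : ℕ) : 𝓞_ℂ_[p]) ^ m) : PowerSeries 𝓞_ℂ_[p])}) :
    P2.RoadFF.FittingCongruenceFrameTwoSlotAt W p κ 𝔭 𝔮 γ ι f S PS :=
  ⟨ΩK, Ωp, L, LS, hΩ, hL, hLS,
    AcSelmer.XAc.map_fittingIdeal_le_span_of_oneSided_congruences_descent_le_cpInt_printed (W.baseChange K) p κ 𝔮 γ
      hS LS R' φ' hφ' Nm Lm e hCh hc⟩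

end Feed

end Summit.BirchSwinnertonDyer.Rank1Residual.X11b

end
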